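import Summits.ValiantsHypothesis.ValiantsHypothesis.Theorems.KPlusLogSqLawTropicalBThreeRowTenFamilySigned
import Summits.ValiantsHypothesis.ValiantsHypothesis.Theorems.KPlusLogSqLawGeneralDesignDoubling
import Summits.ValiantsHypothesis.ValiantsHypothesis.Theorems.KPlusLogSqLawTropicalBFourRowFamilySigned

/-!
# Route «KPlusLogSqLaw» — real corollary of the all-`K` tropical `(3,K)` / `(4,K)` families: `ζ₊sym(6,K) ≥ 9K − 37`, `≥ 8K − 33`; `ζ₊sym(8,K) ≥ 12K − 49`

HONEST FRAMING.  Helper file (cell `pub-symmetroid`, seat val-sym-trop-p3 (g5), 2026-08-27; corollary asked for by the desk, R1743).  LOWER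
census bounds only (a FLOOR refutes no law of record); nothing here bears on `TropicalB` in its window, `WeakLifting`, the doors
(`PosRootLawAt 2 6 19` / `3 4 18`), `MatrixDescartes` (stmt-ValiantsHypothesis-18050) or VP ≠ VNP.

The tropical families `ThreeRowTenFamily` (`T(3,K) ≥ 9K − 37`, `…ThreeRowTenFamilySigned`) and `ThreeRowEight` (`T(3,K) ≥ 8K − 33`,
`…ThreeRowEightSigned`) are NOT symmetric designs (their phases `ψ(a,b)` differ from `ψ(b,a)`; `ThreeRowEight` even has the entry `(0,2)`
absent and `(2,0)` present), so the symmetric patchworking `not_posRootLawAt_of_symmDesign_row` does not apply to them at size 3; the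
tree's GENERAL-design doubling `RealDoubling.not_posRootLawAt_double_of_not_tropRootLawAt` (typer g11, `…GeneralDesignDoubling`: Viro
patchworking + the symmetric doubling `[[0,P],[Pᵀ,0]]`) turns them into REAL SYMMETRIC floors at size `6`:

* `not_posRootLawAt_six_nine (K') : ¬ PosRootLawAt 6 (K' + 5) (9·K' + 7)` — a real symmetric `6 × 6` lacunary pencil with `K = K' + 5` terms and
  at least `9K − 37` positive roots of its determinant exists for every `K ≥ 5`, i.e. **`ζ₊sym(6,K) ≥ 9K − 37`**;
* `not_posRootLawAt_six_eight (K') : ¬ PosRootLawAt 6 (K' + 5) (8·K' + 6)` — the same from the eight-term family (`ζ₊sym(6,K) ≥ 8K − 33`; weaker,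
  recorded because the desk pre-registered it, R1743);
* `not_posRootLawAt_eight_twelve (K') : ¬ PosRootLawAt 8 (K' + 5) (12·K' + 10)` — the `m = 4` family `FourRowFamily.not_tropRootLawAt` doubled to
  size `8`: **`ζ₊sym(8,K) ≥ 12K − 49`** for every `K ≥ 5`.
READING THE CONSTANTS OFF THE TYPE (desk R1791): `PosRootLawAt m K B` says «at most `B` distinct positive roots», so with `K = K' + 5` the three
negations give `≥ 9K' + 8 = 9K − 37`, `≥ 8K' + 7 = 8K − 33` and `≥ 12K' + 11 = 12K − 49` positive roots respectively.
[corollaries by name; no new mathematics]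
-/

set_option linter.dupNamespace false
set_option autoImplicit false

namespace Summit.ValiantsHypothesis.ValiantsHypothesis.Theorems.KPlusLogSqLaw

open Summit.ValiantsHypothesis.ValiantsHypothesis.Theorems.MatrixDescartes.Negative
open Summit.ValiantsHypothesis.ValiantsHypothesis.Theorems.LacunarySymmetroidMatrixDescartes
open Summit.ValiantsHypothesis.ValiantsHypothesis.Theorems.LacunarySymmetroidMatrixDescartes.TropicalCensus

/-- **`ζ₊sym(6,K) ≥ 9K − 37` for every `K ≥ 5`** (general-design doubling of `ThreeRowTenFamily.not_tropRootLawAt`). -/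
theorem not_posRootLawAt_six_nine (K' : ℕ) : ¬ PosRootLawAt 6 (K' + 5) (9 * K' + 7) :=
  RealDoubling.not_posRootLawAt_double_of_not_tropRootLawAt (ThreeRowTenFamily.not_tropRootLawAt K')

/-- `ζ₊sym(6,K) ≥ 8K − 33` for every `K ≥ 5` (general-design doubling of `not_tropRootLawAt_three_family`). -/
theorem not_posRootLawAt_six_eight (K' : ℕ) : ¬ PosRootLawAt 6 (K' + 5) (8 * K' + 6) :=
  RealDoubling.not_posRootLawAt_double_of_not_tropRootLawAt (not_tropRootLawAt_three_family K')

/-- **`ζ₊sym(8,K) ≥ 12K − 49` for every `K ≥ 5`** (general-design doubling of the `m = 4` family, `FourRowFamily.not_tropRootLawAt`). -/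
theorem not_posRootLawAt_eight_twelve (K' : ℕ) : ¬ PosRootLawAt 8 (K' + 5) (12 * K' + 10) :=
  RealDoubling.not_posRootLawAt_double_of_not_tropRootLawAt (FourRowFamily.not_tropRootLawAt K')

end Summit.ValiantsHypothesis.ValiantsHypothesis.Theorems.KPlusLogSqLaw
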